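import Summits.KontsevichZagierPeriods.KontsevichZagierPeriods.Theorems.LinRedNormalFormArrangementNormalFormStubRebaseSimplePosOnePosQuadSector
import Summits.KontsevichZagierPeriods.KontsevichZagierPeriods.Theorems.LinRedNormalFormArrangementNormalFormStubRebaseSimplePosOnePosQuadNorm

/-!
# Stub `stub_rebaseSimplePosOnePos` (crux `ArrangementNormalForm`, line `janus-bands`) —
part `QuadPieces`: the sector pieces of a normalised flat cell are good (`B = 2`)

`B = 2` corner calculus, towards the assembly. Setting: a parallel transverse band over a
product cell of the base `(x₁, x₂, y)` in a frame in which the flat point is the origin, the base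
pole is `y = 0`, the `η`-walls `a < y < b` and the bounds `U < t < V` are linear, the far silent
factors are parallel to an axis (`hL`), the `y`-free rows are either LINEAR (`Rlin`) or FAR with
positive constant (`Rfar`), and the only common zero of `b − a` and `V − U` is the origin (`huniq`).
* `RebasePos.good_piece_std` — the piece `0 < x₁ < x₂` of such a cell: one cut at `x₂ = ε` (rule
  1a; the outer part has no flat point on its closed cell, `good_parCell_of_noFlat`), the far rows
  are inactive on `{0 < x₁ < x₂ < ε}` when `(|r₀| + |r₁|) ε < c` (`hfarR`) and are dropped, and
  the steep sector piece is `RebasePos.good_quadSteepPiece` (part `QuadSector`);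
* `RebasePos.good_piece_signedPerm` — the piece `0 < ℓ_A < ℓ_B` whose image under a signed
  permutation `A` of the silent axes (`x'' = A X`) is the standard piece: the base change of part
  `QuadNorm` (rule 2, `x₀ = 0`, `ℓ₂ = 0`, `τ = 1`) transports all the structure (linear stays
  linear, axis-parallel stays axis-parallel, the far rows keep their constants and do not
  increase `|r₀| + |r₁|`, the flat point stays unique).
Registered as `rebaseSimplePos_pieceStd`.

References: M. Kontsevich, D. Zagier, *Periods* (2001), §1.2, rules (1a), (2).
-/

noncomputable section

open Set MeasureTheory MvPolynomial
open Literature.NumberTheory.Transcendental Literature.ModelTheory.ExponentialFields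

namespace Summit.KontsevichZagierPeriods.ArrangementNormalForm.JanusBands

namespace RebasePos

open SeparatePos

section Pieces

variable {m k k' n : ℕ} (Lc : Fin m → (Fin 2 → ℚ) × ℚ) (Ec : Fin m → ℕ) (ℓ₁ : (Fin 2 → ℚ) × ℚ)

/-- A far row is positive near the origin. -/
theorem far_row_pos (c : (Fin (2 + 1) → ℚ) × ℚ) (hc : c.1 2 = 0) (ε : ℚ)
    (hε : (|c.1 0| + |c.1 1|) * ε < c.2) (z : Fin (2 + 1 + 1) → ℝ) (h0 : |z 0| ≤ ε) (h1 : |z 1| ≤ ε) :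
    0 < affF 2 1 c z := by
  rw [affF_three, hc]
  have hε' : ((|c.1 0| + |c.1 1|) * ε : ℝ) < c.2 := by exact_mod_cast hε
  push_cast at hε'
  have e0 : -(|(c.1 0 : ℝ)| * ε) ≤ (c.1 0 : ℝ) * z 0 := by
    have := neg_abs_le ((c.1 0 : ℝ) * z 0)
    rw [abs_mul] at this
    nlinarith [abs_nonneg (c.1 0 : ℝ), abs_nonneg (z 0)]
  have e1 : -(|(c.1 1 : ℝ)| * ε) ≤ (c.1 1 : ℝ) * z 1 := by
    have := neg_abs_le ((c.1 1 : ℝ) * z 1)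
    rw [abs_mul] at this
    nlinarith [abs_nonneg (c.1 1 : ℝ), abs_nonneg (z 1)]
  simp only [Rat.cast_zero, zero_mul, add_zero]
  linarith

/-- **The standard piece `0 < x₁ < x₂` of a normalised flat cell is good** (`B = 2`). See the
module docstring. `hR` describes the rows: linear rows `Rlin`, far rows `Rfar`, the walls
`a < y < b`, and `0 < x₁ < x₂`. -/
theorem good_piece_std (s : KZ.IntegralRep (2 + 1 + 1)) (R : Fin n → (Fin (2 + 1) → ℚ) × ℚ)
    (Rlin : Fin k → (Fin (2 + 1) → ℚ) × ℚ) (Rfar : Fin k' → (Fin (2 + 1) → ℚ) × ℚ) (a b : (Fin 2 → ℚ) × ℚ)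
    (P : MvPolynomial (Fin 2) ℚ) (U V : (Fin (2 + 1) → ℚ) × ℚ) (ε : ℚ) (hε : 0 < ε)
    (hbd : Bornology.IsBounded s.domain)
    (hdom : s.domain = gDom 2 1 n R (fun _ => Sum.inr U) (fun _ => Sum.inr V))
    (hint : EqOn s.integrand (glit 2 1 P Lc Ec ℓ₁ 0 0 1 (fun _ => some 0)) s.domain)
    (hR : ∀ z : Fin (2 + 1 + 1) → ℝ, (∀ j, 0 < affF 2 1 (R j) z) ↔
      ((∀ j, 0 < affF 2 1 (Rlin j) z) ∧ (∀ j, 0 < affF 2 1 (Rfar j) z) ∧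
        affB 2 1 a z < z 2 ∧ z 2 < affB 2 1 b z ∧ 0 < z 0 ∧ z 0 < z 1))
    (hlin : ∀ j, (Rlin j).2 = 0 ∧ (Rlin j).1 2 = 0)
    (hfarR : ∀ j, (Rfar j).1 2 = 0 ∧ (|(Rfar j).1 0| + |(Rfar j).1 1|) * ε < (Rfar j).2)
    (ha : a.2 = 0) (hb : b.2 = 0)
    (hL : ∀ j, (Lc j).2 ≠ 0 → (Lc j).1 1 ≠ 0 → (Lc j).1 0 = 0)
    (hus : U.1 2 ≠ 0) (hpar : U.1 2 = V.1 2) (hU : U.2 = 0) (hV : V.2 = 0)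
    (hcell : ∀ z : Fin (2 + 1 + 1) → ℝ, (∀ j, 0 < affF 2 1 (R j) z) → 0 < affF 2 1 U z ∧ affF 2 1 U z < affF 2 1 V z)
    (huniq : ∀ z : Fin (2 + 1 + 1) → ℝ, affB 2 1 a z = affB 2 1 b z → affF 2 1 U z = affF 2 1 V z → z 0 = 0 ∧ z 1 = 0) :
    ∃ c ∈ AddSubgroup.closure (GGset 2 2 1), KZ.of s - c ∈ KZ.relations := by
  -- product presentation
  set M₀ : Fin (k + k' + 2) → (Fin 2 → ℚ) × ℚ :=
    Fin.append (Fin.append (fun j => restr 2 (Rlin j)) (fun j => restr 2 (Rfar j))) ![(![1, 0], 0), (![-1, 1], 0)]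
    with hM₀
  have hx0 : ∀ z : Fin (2 + 1 + 1) → ℝ, affB 2 1 (![1, 0], 0) z = z 0 := fun z => by rw [affB_three]; simp
  have hx1 : ∀ z : Fin (2 + 1 + 1) → ℝ, affB 2 1 (![-1, 1], 0) z = z 1 - z 0 := fun z => by rw [affB_three]; simp; ring
  have hM₀iff : ∀ z : Fin (2 + 1 + 1) → ℝ, (∀ j, 0 < affB 2 1 (M₀ j) z) ↔
      ((∀ j, 0 < affF 2 1 (Rlin j) z) ∧ (∀ j, 0 < affF 2 1 (Rfar j) z) ∧ 0 < z 0 ∧ z 0 < z 1) := by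
    intro z
    rw [hM₀, Fin.forall_fin_add, Fin.forall_fin_add, Fin.forall_fin_two]
    simp only [Fin.append_left, Fin.append_right, Matrix.cons_val_zero, Matrix.cons_val_one, hx0, hx1,
      ← affF_yfree _ (hlin _).2, ← affF_yfree _ (hfarR _).1, sub_pos]
    tauto
  have hsec : ∀ z : Fin (2 + 1 + 1) → ℝ, (∀ j, 0 < affF 2 1 (R j) z) ↔ ((∀ j, 0 < affB 2 1 (M₀ j) z) ∧
      affB 2 1 a z < z (Fin.castAdd 1 (Fin.last 2)) ∧ z (Fin.castAdd 1 (Fin.last 2)) < affB 2 1 b z) := by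
    intro z
    rw [hR, hM₀iff, jy_eq]
    tauto
  -- the cut at `x₂ = ε`
  set g : (Fin 2 → ℚ) × ℚ := (![0, -1], ε) with hg
  have hgz : ∀ z : Fin (2 + 1 + 1) → ℝ, affB 2 1 g z = ε - z 1 := fun z => by rw [hg, affB_three]; simp; ring
  have hg0 : g ≠ 0 := fun h => by
    have := congrArg Prod.snd h
    rw [hg] at this
    simp at this
    exact hε.ne' this
  obtain ⟨s₁, s₂, hsub₁, hsub₂, hi₁, hi₂, hd₁, hd₂, hsec₁, hsec₂, hrel⟩ := cutCell s R M₀ a b U V hdom hsec g hg0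
  have hus' : U.1 (Fin.last 2) ≠ 0 := hus
  have hpar' : U.1 (Fin.last 2) = V.1 (Fin.last 2) := hpar
  refine good_of_split hrel ?_ ?_
  swap
  · -- outer part `x₂ > ε`: no flat point
    refine good_parCell_of_noFlat Lc Ec ℓ₁ 0 s₂ _ (Fin.snoc M₀ (-g)) a b P U V (hbd.subset hsub₂) hd₂
      (by rw [hi₂]; exact hint.mono hsub₂) hus' hpar' (fun z hz => hcell z (rows_snoc hz).1) hsec₂ fun z hz h1 h2 => ?_
    obtain ⟨-, hz1⟩ := huniq z h1 h2
    have hle : (ε : ℝ) ≤ z 1 :=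
      le_of_closure_rows continuous_const (continuous_apply 1) (fun w hw => by
        have h := (rows_snoc hw).2
        rw [affF_neg', affF_liftX, hgz] at h
        linarith) z hz
    have hε' : (0 : ℝ) < ε := by exact_mod_cast hε
    linarith
  · -- inner part: drop the far rows and call the steep piece
    have hεz : ∀ z : Fin (2 + 1 + 1) → ℝ, 0 < z 0 → z 0 < z 1 → z 1 < ε → ∀ j, 0 < affF 2 1 (Rfar j) z := by
      intro z h0 h01 h1 j
      refine far_row_pos (Rfar j) (hfarR j).1 ε (hfarR j).2 z ?_ ?_
      · rw [abs_of_pos h0]; linarith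
      · rw [abs_of_pos (h0.trans h01)]; linarith
    have hlo : ∀ z : Fin (2 + 1 + 1) → ℝ, affF 2 1 (wallLoQ a) z = z 2 - affB 2 1 a z := fun z => by
      rw [wallLoQ, affF_three, affB_three, ha]; simp; ring
    have hhi : ∀ z : Fin (2 + 1 + 1) → ℝ, affF 2 1 (wallHiQ b) z = affB 2 1 b z - z 2 := fun z => by
      rw [wallHiQ, affF_three, affB_three, hb]; simp; ring
    have hbox : ∀ z : Fin (2 + 1 + 1) → ℝ, (∀ i : Fin 4, 0 < affF 2 1 (boxRowsQ ε i) z) ↔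
        (0 < z 0 ∧ 0 < z 1 ∧ z 0 < z 1 ∧ z 1 < ε) := fun z => by
      simp [Fin.forall_fin_succ, boxRowsQ, affF_three]
    have hpres : ∀ z : Fin (2 + 1 + 1) → ℝ,
        (∀ j, 0 < affF 2 1 ((Fin.append (Fin.append Rlin ![wallLoQ a, wallHiQ b]) (boxRowsQ ε) : Fin (k + 2 + 4) → _) j) z) ↔
          ((∀ j, 0 < affF 2 1 (R j) z) ∧ z 1 < ε) := by
      intro z
      rw [hR, Fin.forall_fin_add, Fin.forall_fin_add, Fin.forall_fin_two]
      simp only [Fin.append_left, Fin.append_right, Matrix.cons_val_zero, Matrix.cons_val_one, hlo, hhi, hbox, sub_pos]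
      constructor
      · rintro ⟨⟨hl, h3, h4⟩, h5, -, h6, h7⟩
        exact ⟨⟨hl, hεz z h5 h6 h7, h3, h4, h5, h6⟩, h7⟩
      · rintro ⟨⟨hl, -, h3, h4, h5, h6⟩, h7⟩
        exact ⟨⟨hl, h3, h4⟩, h5, h5.trans h6, h6, h7⟩
    have hdom₁ : s₁.domain = gDom 2 1 (k + 2 + 4) (Fin.append (Fin.append Rlin ![wallLoQ a, wallHiQ b]) (boxRowsQ ε))
        (fun _ => Sum.inr U) (fun _ => Sum.inr V) := by
      rw [hd₁]
      ext z
      rw [mem_gDom_one, mem_gDom_one, rowsF_snoc_iff, hpres, affF_liftX, hgz, sub_pos]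
    refine good_quadSteepPiece Lc Ec ℓ₁ ε s₁ Rlin a b P U V hdom₁ (by rw [hi₁]; exact hint.mono hsub₁)
      (fun j => ⟨(hlin j).2, fun h => absurd (hlin j).1 h⟩) hL hus hpar hU hV fun z hz => hcell z ((hpres z).1 hz).1


/-- A signed permutation of the silent axes does not increase `|r₀| + |r₁|` of a row. -/
theorem abs_sum_normFQ_le (A : Matrix (Fin 2) (Fin 2) ℚ) (hrow : |A 0 0| + |A 0 1| ≤ 1 ∧ |A 1 0| + |A 1 1| ≤ 1)
    (c : (Fin (2 + 1) → ℚ) × ℚ) (hc : c.1 2 = 0) :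
    |(normFQ 0 A 1 0 c).1 0| + |(normFQ 0 A 1 0 c).1 1| ≤ |c.1 0| + |c.1 1| := by
  simp only [normFQ, hc, Matrix.cons_val_zero, Matrix.cons_val_one, Prod.fst_zero, Pi.zero_apply, mul_zero, add_zero,
    zero_mul]
  have h1 := abs_add_le (c.1 0 * A 0 0) (c.1 1 * A 1 0)
  have h2 := abs_add_le (c.1 0 * A 0 1) (c.1 1 * A 1 1)
  rw [abs_mul, abs_mul] at h1 h2
  nlinarith [abs_nonneg (c.1 0), abs_nonneg (c.1 1), abs_nonneg (A 0 0), abs_nonneg (A 0 1), abs_nonneg (A 1 0),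
    abs_nonneg (A 1 1), hrow.1, hrow.2]

/-- **A signed-permutation image of the standard piece is good** (`B = 2`). As `good_piece_std`,
for the piece `0 < ℓ_A < ℓ_B` with `ℓ_A`, `ℓ_B` the rows of `A⁻¹` (`x'' = A X` maps it onto
`0 < X₁ < X₂`), `A` a signed permutation of the silent axes: `A A⁻¹ = A⁻¹ A = 1`, shape
`hshape`, row sums `hrow`. -/
theorem good_piece_signedPerm (A Ai : Matrix (Fin 2) (Fin 2) ℚ) (hA : A * Ai = 1) (hA' : Ai * A = 1)
    (hshape : (A 0 0 = 0 ∧ A 1 1 = 0) ∨ (A 0 1 = 0 ∧ A 1 0 = 0))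
    (hrow : |A 0 0| + |A 0 1| ≤ 1 ∧ |A 1 0| + |A 1 1| ≤ 1)
    (s : KZ.IntegralRep (2 + 1 + 1)) (R : Fin n → (Fin (2 + 1) → ℚ) × ℚ)
    (Rlin : Fin k → (Fin (2 + 1) → ℚ) × ℚ) (Rfar : Fin k' → (Fin (2 + 1) → ℚ) × ℚ) (a b : (Fin 2 → ℚ) × ℚ)
    (P : MvPolynomial (Fin 2) ℚ) (U V : (Fin (2 + 1) → ℚ) × ℚ) (ε : ℚ) (hε : 0 < ε)
    (hbd : Bornology.IsBounded s.domain)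
    (hdom : s.domain = gDom 2 1 n R (fun _ => Sum.inr U) (fun _ => Sum.inr V))
    (hint : EqOn s.integrand (glit 2 1 P Lc Ec ℓ₁ 0 0 1 (fun _ => some 0)) s.domain)
    (hR : ∀ z : Fin (2 + 1 + 1) → ℝ, (∀ j, 0 < affF 2 1 (R j) z) ↔
      ((∀ j, 0 < affF 2 1 (Rlin j) z) ∧ (∀ j, 0 < affF 2 1 (Rfar j) z) ∧
        affB 2 1 a z < z 2 ∧ z 2 < affB 2 1 b z ∧ 0 < affB 2 1 (![Ai 0 0, Ai 0 1], 0) z ∧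
          affB 2 1 (![Ai 0 0, Ai 0 1], 0) z < affB 2 1 (![Ai 1 0, Ai 1 1], 0) z))
    (hlin : ∀ j, (Rlin j).2 = 0 ∧ (Rlin j).1 2 = 0)
    (hfarR : ∀ j, (Rfar j).1 2 = 0 ∧ (|(Rfar j).1 0| + |(Rfar j).1 1|) * ε < (Rfar j).2)
    (ha : a.2 = 0) (hb : b.2 = 0)
    (hL : ∀ j, (Lc j).2 ≠ 0 → (Lc j).1 1 = 0 ∨ (Lc j).1 0 = 0)
    (hus : U.1 2 ≠ 0) (hpar : U.1 2 = V.1 2) (hU : U.2 = 0) (hV : V.2 = 0)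
    (hcell : ∀ z : Fin (2 + 1 + 1) → ℝ, (∀ j, 0 < affF 2 1 (R j) z) → 0 < affF 2 1 U z ∧ affF 2 1 U z < affF 2 1 V z)
    (huniq : ∀ z : Fin (2 + 1 + 1) → ℝ, affB 2 1 a z = affB 2 1 b z → affF 2 1 U z = affF 2 1 V z → z 0 = 0 ∧ z 1 = 0) :
    ∃ c ∈ AddSubgroup.closure (GGset 2 2 1), KZ.of s - c ∈ KZ.relations := by
  obtain ⟨s', hbd', hdom', hint', hmem', hrel'⟩ :=
    quadNormalize 0 A Ai 1 0 hA hA' (by norm_num) s R Lc Ec P ℓ₁ U V hbd hdom hint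
  suffices h' : ∃ c ∈ AddSubgroup.closure (GGset 2 2 1), KZ.of s' - c ∈ KZ.relations by
    obtain ⟨c, hc, hc'⟩ := h'
    exact ⟨c, hc, by have := add_mem hrel' hc'; rwa [sub_add_sub_cancel] at this⟩
  -- the two piece rows become the coordinates
  have hAi : ∀ i, normLQ 0 A (![Ai i 0, Ai i 1], 0) = (Pi.single i 1, 0) := by
    intro i
    have h := fun j => congrFun (congrFun hA' i) j
    simp only [Matrix.mul_apply, Fin.sum_univ_two, Matrix.one_apply] at h
    refine Prod.ext (funext fun j => ?_) (by simp [normLQ])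
    have hj := h j
    fin_cases i <;> fin_cases j <;> simp [normLQ] at hj ⊢ <;> linarith
  have hcoord : ∀ (i : Fin 2) (w : Fin (2 + 1 + 1) → ℝ),
      affB 2 1 (![Ai i 0, Ai i 1], 0) (normMapQ 0 A 1 0 w) = w (Fin.castSucc (Fin.castSucc i)) := by
    intro i w
    rw [← affB_normLQ 0 A 1 0, hAi, affB_three]
    fin_cases i <;> simp
  have hnm : ∀ w : Fin (2 + 1 + 1) → ℝ, normMapQ 0 A 1 0 w 2 = w 2 := fun w => by simp [normMapQ_two]
  refine good_piece_std (fun j => normLQ 0 A (Lc j)) Ec ℓ₁ s' _ (fun j => normFQ 0 A 1 0 (Rlin j))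
    (fun j => normFQ 0 A 1 0 (Rfar j)) (normLQ 0 A a) (normLQ 0 A b) (normPQ 0 A 1 P) (normFQ 0 A 1 0 U)
    (normFQ 0 A 1 0 V) ε hε hbd' hdom' hint' (fun w => ?_) (fun j => ?_) (fun j => ?_) ?_ ?_ (fun j h2 h11 => ?_) ?_ ?_ ?_ ?_
    (fun w hw => ?_) (fun w h1 h2 => ?_)
  · -- the rows
    simp only [affF_normFQ, affB_normLQ 0 A 1 0, hR, hcoord, hnm]
    exact Iff.rfl
  · exact ⟨by simp [normFQ, (hlin j).1, (hlin j).2], by simp [normFQ, (hlin j).2]⟩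
  · refine ⟨by simp [normFQ, (hfarR j).1], ?_⟩
    have h1 := abs_sum_normFQ_le A hrow (Rfar j) (hfarR j).1
    have h2 : (normFQ 0 A 1 0 (Rfar j)).2 = (Rfar j).2 := by simp [normFQ, (hfarR j).1]
    rw [h2]
    calc _ ≤ (|(Rfar j).1 0| + |(Rfar j).1 1|) * ε := mul_le_mul_of_nonneg_right h1 hε.le
      _ < _ := (hfarR j).2
  · simp [normLQ, ha]
  · simp [normLQ, hb]
  · -- the far factors stay parallel to an axis
    have h2' : (Lc j).2 ≠ 0 := by simpa [normLQ] using h2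
    rcases hL j h2' with h1 | h0
    · simp only [normLQ, h1, zero_mul, add_zero, Matrix.cons_val_zero, Matrix.cons_val_one] at h11 ⊢
      rcases hshape with ⟨h00, -⟩ | ⟨h01, -⟩
      · simp [h00]
      · exact absurd (by simp [h01]) h11
    · simp only [normLQ, h0, zero_mul, zero_add, Matrix.cons_val_zero, Matrix.cons_val_one] at h11 ⊢
      rcases hshape with ⟨-, h11'⟩ | ⟨-, h10⟩
      · exact absurd (by simp [h11']) h11
      · simp [h10]
  · simpa [normFQ] using hus
  · simp [normFQ, hpar]
  · simp [normFQ, hU]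
  · simp [normFQ, hV]
  · -- the bounds
    have hz : ∀ j, 0 < affF 2 1 (R j) (normMapQ 0 A 1 0 w) := fun j => by rw [← affF_normFQ 0 A 1 0]; exact hw j
    have h := hcell _ hz
    rwa [← affF_normFQ 0 A 1 0, ← affF_normFQ 0 A 1 0] at h
  · -- the flat point stays unique
    rw [affB_normLQ 0 A 1 0, affB_normLQ 0 A 1 0] at h1
    rw [affF_normFQ, affF_normFQ] at h2
    obtain ⟨h0, h1'⟩ := huniq _ h1 h2
    have key := normInvQ_normMapQ 0 A Ai 1 0 hA' (by norm_num) w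
    have e0 := congrFun key 0
    have e1 := congrFun key 1
    simp only [normInvQ, h0, h1', Matrix.cons_val_zero, Matrix.cons_val_one] at e0 e1
    simp at e0 e1
    exact ⟨e0.symm, e1.symm⟩

end Pieces


end RebasePos

/-- **Registered part of `stub_rebaseSimplePosOnePos` (line `janus-bands`, `B = 2` corner
calculus): the standard piece `0 < x₁ < x₂` of a normalised flat cell is good**
(`RebasePos.good_piece_std`): rows linear (`Rlin`) or far with `(|r₀| + |r₁|) ε < c` (`Rfar`),
linear walls and bounds, far silent factors parallel to an axis, unique flat point at the origin —
one cut at `x₂ = ε` (outer part without flat point), the far rows dropped, and the steep sector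
piece of part `QuadSector`. -/
theorem rebaseSimplePos_pieceStd (m k k' n : ℕ) (Lc : Fin m → (Fin 2 → ℚ) × ℚ) (Ec : Fin m → ℕ) (ℓ₁ : (Fin 2 → ℚ) × ℚ) (s : KZ.IntegralRep (2 + 1 + 1)) (R : Fin n → (Fin (2 + 1) → ℚ) × ℚ) (Rlin : Fin k → (Fin (2 + 1) → ℚ) × ℚ) (Rfar : Fin k' → (Fin (2 + 1) → ℚ) × ℚ) (a b : (Fin 2 → ℚ) × ℚ) (P : MvPolynomial (Fin 2) ℚ) (U V : (Fin (2 + 1) → ℚ) × ℚ) (ε : ℚ) (hε : 0 < ε) (hbd : Bornology.IsBounded s.domain) (hdom : s.domain = SeparatePos.gDom 2 1 n R (fun _ => Sum.inr U) (fun _ => Sum.inr V)) (hint : Set.EqOn s.integrand (RebasePos.glit 2 1 P Lc Ec ℓ₁ 0 0 1 (fun _ => some 0)) s.domain) (hR : ∀ z : Fin (2 + 1 + 1) → ℝ, (∀ j, 0 < SeparatePos.affF 2 1 (R j) z) ↔ ((∀ j, 0 < SeparatePos.affF 2 1 (Rlin j) z) ∧ (∀ j, 0 < SeparatePos.affF 2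 1 (Rfar j) z) ∧ SeparatePos.affB 2 1 a z < z 2 ∧ z 2 < SeparatePos.affB 2 1 b z ∧ 0 < z 0 ∧ z 0 < z 1)) (hlin : ∀ j, (Rlin j).2 = 0 ∧ (Rlin j).1 2 = 0) (hfarR : ∀ j, (Rfar j).1 2 = 0 ∧ (|(Rfar j).1 0| + |(Rfar j).1 1|) * ε < (Rfar j).2) (ha : a.2 = 0) (hb : b.2 = 0) (hL : ∀ j, (Lc j).2 ≠ 0 → (Lc j).1 1 ≠ 0 → (Lc j).1 0 = 0) (hus : U.1 2 ≠ 0) (hpar : U.1 2 = V.1 2) (hU : U.2 = 0) (hV : V.2 = 0) (hcell : ∀ z : Fin (2 + 1 + 1) → ℝ, (∀ j, 0 < SeparatePos.affF 2 1 (R j) z) → 0 < SeparatePos.affF 2 1 U z ∧ SeparatePos.affF 2 1 U z < SeparatePos.affF 2 1 V z) (huniq : ∀ z : Fin (2 + 1 + 1) → ℝ, SeparatePos.affB 2 1 a z = SeparatePos.affB 2 1 b z → SeparatePos.affF 2 1 U z = SeparatePos.affF 2 1 V z → z 0 = 0 ∧ z 1 = 0) : ∃ c ∈ AddSubgroup.closure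 (SeparatePos.GGset 2 2 1), KZ.of s - c ∈ KZ.relations :=
  RebasePos.good_piece_std Lc Ec ℓ₁ s R Rlin Rfar a b P U V ε hε hbd hdom hint hR hlin hfarR ha hb hL hus hpar hU hV hcell huniq

end Summit.KontsevichZagierPeriods.ArrangementNormalForm.JanusBands
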